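import Summits.ResolutionOfSingularities.ResolutionOfSingularities.Theorems.FrobeniusClosingPatchingRelPerfectMonomialPositionStrata
import Summits.ResolutionOfSingularities.ResolutionOfSingularities.Theorems.FrobeniusClosingPatchingRelPerfectMonomialPolyhedraGame
import HarnessLib

/-!
# Crux `PatchingRelPerfect` (stmt-ResolutionOfSingularities-16161), chain w52 — M2-strong, SCHEME DICTIONARY
# part 3: THE BRIDGE, invariant and win read-out («global permissible polyhedra game ⇒ monomial sums»)

[OURS · L1 W5.2 · TargetsF3 (m) M2-strong, background line (plan-1 g7 RULING 06:34:44Z): «stub-4 keeps the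
SCHEME dictionary, res-type-075 the COMBINATORIAL half»] The combinatorial half is res-type-075's
`PolyhedraGame.GlobalPermissiblePolyhedraGame` (p507620: states `(B, Str, A)`, permissible moves = strata
inside the cosupport, exact star-subdivision rule `moveStrata`, total transforms `c = 0`, win = a least
restricted exponent at every stratum, `Winnable 0`).  THIS FILE PROVES THE DICTIONARY:

  **`monomialSumPrincipalization_of_game_of_nodup`** —
  `GlobalPermissiblePolyhedraGame → (M2 = DepthTargets.MonomialSumPrincipalization, for boundaries
  without repeated entries)`,

by induction on `Winnable`, through the invariant `GameInv` relating a game state to a scheme-side datum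
`(X, Es, 𝒦)` via a labelling of boundary POSITIONS by game indices: live indices = labels of positions;
every set of positions whose divisors have a common point is (labels to) a game stratum — the game's
stratum complex may be LARGER than the geometric one (initially: all subsets), which costs the game
nothing (`GlobalPermissiblePolyhedraGame` quantifies over all well-formed states) and spares the
dictionary every fibre-non-emptiness statement; game exponent vectors and scheme exponent lists AGREE AT
POINTED POSITIONS (positions whose divisor is non-empty) — the only ones geometry sees.  The step is the
scheme side of part 1/2 + `…MonomialSumStratumStep` (p504780): blow up `{Es[k] : lab k ∈ J}` (regular, inside
the cosupport by permissibility, or empty), transform every member by `transformExp · π T 0`, new cliques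
⊆ `moveStrata` (`not_forall_mem_support_transformBoundary`, `common_point_old_of_new`), agreement persists
(`weightOf_image_nthSheaf_eq_sum` under `PointedDistinct`).  The win is read by
`isLocallyPrincipal_monomialSum_of_principal` (a least restricted exponent at the clique of `x` makes the
stalk of the sum the principal stalk of that member).

Fact-free, any dimension; nothing here is a statement of the manuscript under review.

## References

* J. Kollár, *Lectures on Resolution of Singularities* (2007), (3.111) Step 3. [Kollar2007]
* M. Spivakovsky, *A solution to Hironaka's polyhedra game* (1983). [Spivakovsky1983]
-/

-- `Summit.<Summit>.<Sub>.Theorems` with `Sub = Summit` (single-conjunct summit, D-0017)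
set_option linter.dupNamespace false

noncomputable section

open CategoryTheory AlgebraicGeometry TopologicalSpace IsLocalRing
open Literature.AlgebraicGeometry.Resolution

namespace Summit.ResolutionOfSingularities.ResolutionOfSingularities.Theorems

namespace MonomialCleanup

open DepthTargets (monomialSum monomialSum_nil monomialSum_cons)
open PolyhedraGame (State Winnable Permissible Principal PrincipalAt moveExp moveStrata move weight
  GlobalPermissiblePolyhedraGame mem_moveStrata_iff moveExp_apply_of_ne moveExp_apply_self)

universe u

/-! ## The invariant -/

section Invariant

variable {X : Scheme.{u}}

/-- A position is POINTED if its divisor is non-empty. [folklore] -/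
def Pointed (Es : List X.IdealSheafData) (k : ℕ) : Prop := ∃ x : X, x ∈ (nthSheaf Es k).support

/-- A game exponent vector and a scheme exponent list AGREE (through the labelling `lab`) at every pointed
position. [folklore] -/
def Agree (Es : List X.IdealSheafData) (lab : ℕ → ℕ) (A : List (X.IdealSheafData × ℕ)) (α : ℕ →₀ ℕ) : Prop :=
  ∀ k, k < Es.length → Pointed Es k → α (lab k) = nthExp A k

/-- [OURS · W5.2 M2-strong] **The dictionary's invariant** between a game state `s` and a scheme datum
`(X, Es, 𝒦)` with position labelling `lab`. -/
structure GameInv (s : State) (Es : List X.IdealSheafData) (𝒦 : List (List (X.IdealSheafData × ℕ)))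
    (lab : ℕ → ℕ) : Prop where
  /-- the boundary has simple normal crossings -/
  snc : HasSNC Es
  /-- every member lives on the boundary -/
  bd : ∀ A ∈ 𝒦, boundaryOf A = Es
  /-- pointed positions carry distinct divisors -/
  pd : PointedDistinct Es
  /-- the labelling is injective on positions -/
  lab_inj : ∀ k k', k < Es.length → k' < Es.length → lab k = lab k' → k = k'
  /-- the live indices are the labels of the positions -/
  B_eq : s.B = (Finset.range Es.length).image lab
  /-- strata are sets of live indices -/
  str_B : ∀ T ∈ s.Str, T ⊆ s.B
  /-- game exponent vectors only involve live indices -/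
  supp : ∀ α ∈ s.A, ∀ b, α b ≠ 0 → b ∈ s.B
  /-- every position clique (positions whose divisors share a point) labels to a game stratum -/
  str : ∀ S : Finset ℕ, (∀ k ∈ S, k < Es.length) → (∃ x : X, ∀ k ∈ S, x ∈ (nthSheaf Es k).support) →
    S.image lab ∈ s.Str
  /-- every member has an agreeing game vector … -/
  fwd : ∀ A ∈ 𝒦, ∃ α ∈ s.A, Agree Es lab A α
  /-- … and conversely -/
  bwd : ∀ α ∈ s.A, ∃ A ∈ 𝒦, Agree Es lab A α

/-- Members have the length of the boundary. [folklore] -/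
theorem GameInv.length_eq {s : State} {Es : List X.IdealSheafData} {𝒦 : List (List (X.IdealSheafData × ℕ))}
    {lab : ℕ → ℕ} (hinv : GameInv s Es 𝒦 lab) {A : List (X.IdealSheafData × ℕ)} (hA : A ∈ 𝒦) :
    A.length = Es.length := by
  rw [← length_boundaryOf A, hinv.bd A hA]

/-- Labels of positions are live. [folklore] -/
theorem GameInv.lab_mem {s : State} {Es : List X.IdealSheafData} {𝒦 : List (List (X.IdealSheafData × ℕ))}
    {lab : ℕ → ℕ} (hinv : GameInv s Es 𝒦 lab) {k : ℕ} (hk : k < Es.length) : lab k ∈ s.B := by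
  rw [hinv.B_eq]; exact Finset.mem_image_of_mem _ (Finset.mem_range.mpr hk)

end Invariant

/-! ## Reading the win: a principal game state gives a locally principal sum -/

section Win

variable {X : Scheme.{u}}

/-- The stalk of a sum of monomial ideals is below `I` iff every member's stalk is. [folklore] -/
theorem stalkIdeal_monomialSum_le_iff (𝒦 : List (List (X.IdealSheafData × ℕ))) (x : X)
    (I : Ideal (X.presheaf.stalk x)) :
    stalkIdeal (monomialSum 𝒦) x ≤ I ↔ ∀ A ∈ 𝒦, stalkIdeal (monomialIdeal A) x ≤ I := by
  induction 𝒦 with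
  | nil =>
    constructor
    · intro _ A hA; simp at hA
    · intro _
      rw [monomialSum_nil]
      obtain ⟨U, hU, hxU, -⟩ := exists_isAffineOpen_mem_and_subset (X := X) (x := x) (U := ⊤) (Opens.mem_top _)
      rw [stalkIdeal_eq_map_germ ⊥ ⟨U, hU⟩ hxU, Scheme.IdealSheafData.ideal_bot, Pi.bot_apply, Ideal.map_bot]
      exact bot_le
  | cons A 𝒦 ih =>
    rw [monomialSum_cons, stalkIdeal_sup, sup_le_iff, ih]
    simp

open Classical in
/-- The exponent of a boundary divisor is the sum of the exponents at the positions carrying it. [folklore] -/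
theorem expOf_eq_sum_nthExp (A : List (X.IdealSheafData × ℕ)) (K : X.IdealSheafData) :
    expOf A K = ∑ k ∈ Finset.range A.length, (if nthSheaf (boundaryOf A) k = K then nthExp A k else 0) := by
  rw [expOf, weightOf_eq_sum_nthExp]
  simp only [Finset.mem_singleton]

/-- A single position carrying `K` bounds `expOf A K` from below. [folklore] -/
theorem nthExp_le_expOf (A : List (X.IdealSheafData × ℕ)) {k : ℕ} (hk : k < A.length) :
    nthExp A k ≤ expOf A (nthSheaf (boundaryOf A) k) := by
  classical
  rw [expOf_eq_sum_nthExp]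
  have h := Finset.single_le_sum (s := Finset.range A.length)
    (f := fun j => if nthSheaf (boundaryOf A) j = nthSheaf (boundaryOf A) k then nthExp A j else 0)
    (fun _ _ => Nat.zero_le _) (Finset.mem_range.mpr hk)
  simp only [if_true] at h
  exact h

/-- **A principal game state makes the sum locally principal**: at `x`, the positions through `x` form a
clique, hence a game stratum; the member agreeing with the least restricted game vector has the
largest stalk, which is then the stalk of the sum, a principal monomial stalk. [folklore] -/
theorem isLocallyPrincipal_monomialSum_of_principal [IsLocallyNoetherian X] {s : State}
    {Es : List X.IdealSheafData} {𝒦 : List (List (X.IdealSheafData × ℕ))} {lab : ℕ → ℕ}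
    (hinv : GameInv s Es 𝒦 lab) (hprin : Principal s) :
    IsLocallyPrincipal (monomialSum 𝒦) := by
  classical
  intro x
  haveI : IsRegularLocalRing (X.presheaf.stalk x) := (hinv.snc x).1
  refine isLocallyPrincipalAt_of_isPrincipal_stalkIdeal ?_
  -- the clique of `x`
  set S : Finset ℕ := (Finset.range Es.length).filter fun k => x ∈ (nthSheaf Es k).support with hS
  have hSlt : ∀ k ∈ S, k < Es.length := fun k hk => Finset.mem_range.mp (Finset.mem_filter.mp hk).1
  have hSx : ∀ k ∈ S, x ∈ (nthSheaf Es k).support := fun k hk => (Finset.mem_filter.mp hk).2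
  have hstr : S.image lab ∈ s.Str := hinv.str S hSlt ⟨x, hSx⟩
  obtain ⟨α₀, hα₀, hmin⟩ := hprin _ hstr
  obtain ⟨A₀, hA₀, hagr₀⟩ := hinv.bwd α₀ hα₀
  -- every member's stalk is contained in the stalk of `A₀`
  have hle : ∀ A ∈ 𝒦, stalkIdeal (monomialIdeal A) x ≤ stalkIdeal (monomialIdeal A₀) x := by
    intro A hA
    obtain ⟨α, hα, hagr⟩ := hinv.fwd A hA
    have hbd : boundaryOf A₀ = boundaryOf A := (hinv.bd A₀ hA₀).trans (hinv.bd A hA).symm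
    refine stalkIdeal_monomialIdeal_le_of_forall_expOf_le hbd x fun K _ hxK => ?_
    rw [expOf_eq_sum_nthExp, expOf_eq_sum_nthExp, hinv.length_eq hA₀, hinv.length_eq hA, hinv.bd A₀ hA₀,
      hinv.bd A hA]
    refine Finset.sum_le_sum fun k hk => ?_
    by_cases hKk : nthSheaf Es k = K
    · rw [if_pos hKk, if_pos hKk]
      have hklt : k < Es.length := Finset.mem_range.mp hk
      have hxk : x ∈ (nthSheaf Es k).support := hKk ▸ hxK
      have hkS : lab k ∈ S.image lab := Finset.mem_image_of_mem _ (Finset.mem_filter.mpr ⟨hk, hxk⟩)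
      rw [← hagr₀ k hklt ⟨x, hxk⟩, ← hagr k hklt ⟨x, hxk⟩]
      exact hmin α hα _ hkS
    · rw [if_neg hKk, if_neg hKk]
  have heq : stalkIdeal (monomialSum 𝒦) x = stalkIdeal (monomialIdeal A₀) x :=
    le_antisymm ((stalkIdeal_monomialSum_le_iff 𝒦 x _).mpr hle)
      ((stalkIdeal_monomialSum_le_iff 𝒦 x _).mp le_rfl A₀ hA₀)
  rw [heq]
  obtain ⟨g, hg, -, -⟩ := exists_generator_stalkIdeal_monomialIdeal A₀ (x := x) fun p hp hxp =>
    hinv.snc.exists_generator_of_mem ((hinv.bd A₀ hA₀) ▸ fst_mem_boundaryOf hp) hxp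
  exact ⟨g, hg⟩

end Win

/-! ## The step: one game move on the scheme side -/

section Step

variable {X : Scheme.{u}} [IsLocallyNoetherian X] {s : State} {Es : List X.IdealSheafData}
  {𝒦 : List (List (X.IdealSheafData × ℕ))} {lab : ℕ → ℕ}

/-- The positions labelled into `J`. [folklore] -/
def posOf (Es : List X.IdealSheafData) (lab : ℕ → ℕ) (J : Finset ℕ) : Finset ℕ := by
  classical exact (Finset.range Es.length).filter fun k => lab k ∈ J

omit [IsLocallyNoetherian X] in
/-- Membership in `posOf`. [folklore] -/
theorem mem_posOf_iff {J : Finset ℕ} {k : ℕ} : k ∈ posOf Es lab J ↔ k < Es.length ∧ lab k ∈ J := by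
  classical
  simp only [posOf, Finset.mem_filter, Finset.mem_range]

omit [IsLocallyNoetherian X] in
/-- A set of live indices is the label image of its positions. [folklore] -/
theorem image_lab_posOf (hinv : GameInv s Es 𝒦 lab) {J : Finset ℕ} (hJ : J ⊆ s.B) :
    (posOf Es lab J).image lab = J := by
  classical
  ext j
  simp only [Finset.mem_image, mem_posOf_iff]
  constructor
  · rintro ⟨k, ⟨-, hk⟩, rfl⟩; exact hk
  · intro hj
    have hjB := hJ hj
    rw [hinv.B_eq] at hjB
    obtain ⟨k, hk, rfl⟩ := Finset.mem_image.mp hjB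
    exact ⟨k, ⟨Finset.mem_range.mp hk, hj⟩, rfl⟩

omit [IsLocallyNoetherian X] in
/-- The weight of a game vector on `J` is the sum of its values at the positions of `J`. [folklore] -/
theorem weight_eq_sum_posOf (hinv : GameInv s Es 𝒦 lab) {J : Finset ℕ} (hJ : J ⊆ s.B) (α : ℕ →₀ ℕ) :
    weight J α = ∑ k ∈ posOf Es lab J, α (lab k) := by
  classical
  conv_lhs => rw [← image_lab_posOf hinv hJ]
  rw [weight, Finset.sum_image]
  intro k hk k' hk' h
  rw [Finset.mem_coe, mem_posOf_iff] at hk hk'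
  exact hinv.lab_inj k k' hk.1 hk'.1 h

open Classical in
omit [IsLocallyNoetherian X] in
/-- **The centre of a permissible move lies in the cosupport of every member** (or is empty): at a point of
`V({Es[k] : lab k ∈ J})` all positions of `J` are pointed, some position of `J` carries a positive game
exponent, hence a positive scheme exponent. [folklore] -/
theorem support_centre_subset (hinv : GameInv s Es 𝒦 lab) {J : Finset ℕ} (hJ : Permissible s J) :
    ((((posOf Es lab J).image (nthSheaf Es)).sup id).support : Set X) ⊆ (monomialSum 𝒦).support := by
  obtain ⟨hJstr, -, hJw⟩ := hJ
  have hJB : J ⊆ s.B := hinv.str_B J hJstr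
  intro x hx
  rw [coe_support_monomialSum]
  refine Set.mem_iInter₂.mpr fun A hA => ?_
  have hxT := (mem_support_finsetSup_iff _ x).mp hx
  have hxP : ∀ k ∈ posOf Es lab J, x ∈ (nthSheaf Es k).support := fun k hk =>
    hxT _ (Finset.mem_image_of_mem _ hk)
  obtain ⟨α, hα, hagr⟩ := hinv.fwd A hA
  have hw := hJw α hα
  rw [weight_eq_sum_posOf hinv hJB] at hw
  obtain ⟨k, hkP, hk⟩ : ∃ k ∈ posOf Es lab J, 1 ≤ α (lab k) := by
    by_contra h
    push Not at h
    have : ∑ k ∈ posOf Es lab J, α (lab k) = 0 := Finset.sum_eq_zero fun k hk => by have := h k hk; omega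
    omega
  have hklt : k < Es.length := (mem_posOf_iff.mp hkP).1
  rw [hagr k hklt ⟨x, hxP k hkP⟩] at hk
  have hkA : k < A.length := by rw [hinv.length_eq hA]; exact hklt
  have hKA : nthSheaf (boundaryOf A) k ∈ sheaves A := mem_sheaves_iff.mpr (nthSheaf_mem (by rwa [length_boundaryOf]))
  have hle := nthExp_le_expOf A hkA
  have hxk : x ∈ (nthSheaf (boundaryOf A) k).support := by rw [hinv.bd A hA]; exact hxP k hkP
  exact mem_support_monomialIdeal hKA (by omega) hxk

open Classical in
/-- **The total transform of the sum along the move is the sum of the transformed members.** [folklore] -/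
theorem comap_monomialSum_move (hinv : GameInv s Es 𝒦 lab) (P : Finset ℕ) (hP : ∀ k ∈ P, k < Es.length)
    {X' : Scheme.{u}} {π : X' ⟶ X} (hπ : IsBlowup π ((P.image (nthSheaf Es)).sup id)) :
    (monomialSum 𝒦).comap π = monomialSum (𝒦.map fun A => transformExp A π (P.image (nthSheaf Es)) 0) := by
  classical
  rw [comap_monomialSum_eq_pow_mul hinv.snc hinv.bd (image_nthSheaf_subset hP) hπ (fun A _ => Nat.zero_le _),
    pow_zero, Scheme.IdealSheafData.one_eq_top, Scheme.IdealSheafData.top_mul]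

end Step

end MonomialCleanup

end Summit.ResolutionOfSingularities.ResolutionOfSingularities.Theorems

end
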